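import Literature.NumberTheory.ModularForms.BinaryQuadGaussSumBasic
import Literature.NumberTheory.LFunctions.KloostermanWeilReduction
import HarnessLib

/-!
# Gauss sums of binary quadratic forms, V: multiplicativity in the modulus (Chinese remainder
# theorem) and the sum as explicit exponentials over `0 ≤ x, y < c`

Topic `NumberTheory/ModularForms` (namespace `Literature.NumberTheory.ModularForms`), continuing
`BinaryQuadGaussSum{,Basic}.lean`. Everything here is PROVED (theorems only; no definition, no
named fact).

* `binQuadGaussSum_mul_of_coprime` — **`G(a, c₁c₂; f, w) = G(c₂a, c₁; f, w) · G(c₁a, c₂; f, w)`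
  for coprime `c₁, c₂`** (integer numerator and twist, read modulo each factor): the Chinese
  remainder theorem `e(n/(c₁c₂)) = e(c̄₂n/c₁)e(c̄₁n/c₂)` (the tree's `stdAddChar_eq_mul_of_coprime`)
  and the substitutions `x ↦ c̄₂x (mod c₁)`, `x ↦ c̄₁x (mod c₂)` (`c₂c̄₂² ≡ c̄₂`), exactly as in the
  one-variable `quadGaussSum_mul_of_coprime` (Andrianov–Zhuravlev (4.49):
  `G_d(c) = G_{d₁}(cb₂)G_{d₂}(cb₁)`). This reduces every modulus to prime powers; with the
  odd-modulus evaluation (files III/IV) and the `2`-power recursion (file VI) it covers all `c ≥ 1`.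
* `binQuadGaussSum_eq_sum_range` — the sum as `∑_{x<c}∑_{y<c} exp(2πi(a f(x,y) + w₁x + w₂y)/c)`
  with integer data (the form in which splittings `x = u + Mv` of the range are performed).

## References

* A. N. Andrianov, V. G. Zhuravlev, *Modular Forms and Hecke Operators*, Transl. Math. Monogr.
  145, AMS (1995/2015), Ch. 1 §4.3 (4.10), §4.5 (4.49) (proof of Lemma 4.13) [AndrianovZhuravlev2015].
* B. Conrey, H. Iwaniec, Acta Arith. 103 (2002) 259–312, §3 (3.14)–(3.21) [ConreyIwaniec2002].
-/

noncomputable section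

open Complex Finset

namespace Literature.NumberTheory.ModularForms

open Literature.NumberTheory.EllipticCurves.ModularForms
open Literature.NumberTheory.QuadraticFields.Quadratic (BinQF)
open Literature.NumberTheory.LFunctions (sum_zmod_eq_sum_range sum_range_mul_eq_sum_sum
  stdAddChar_natCast norm_stdAddChar stdAddChar_eq_mul_of_coprime)

/-! ### The sum over representatives `0 ≤ x, y < c` -/

/-- `G(a, c; f, w)` as a double sum of explicit exponentials over the representatives
`0 ≤ x, y < c`, for integer numerator and twist:
`G(a, c; f, w) = ∑_{x<c} ∑_{y<c} exp(2πi (a(Ax² + Bxy + Cy²) + w₁x + w₂y)/c)`.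
[cite: AndrianovZhuravlev2015, Ch. 1 §4.3 (4.10)] -/
theorem binQuadGaussSum_eq_sum_range {c : ℕ} [NeZero c] (f : BinQF) (a w₁ w₂ : ℤ) :
    binQuadGaussSum c f a w₁ w₂ = ∑ x ∈ range c, ∑ y ∈ range c,
      cexp (2 * Real.pi * I *
        ((a * (f.a * x ^ 2 + f.b * x * y + f.c * y ^ 2) + w₁ * x + w₂ * y : ℤ) : ℂ) / c) := by
  rw [binQuadGaussSum_eq_sum_sum, sum_zmod_eq_sum_range]
  refine sum_congr rfl fun x _ ↦ ?_
  rw [sum_zmod_eq_sum_range]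
  refine sum_congr rfl fun y _ ↦ ?_
  rw [← ZMod.stdAddChar_coe]
  congr 1
  push_cast
  ring

/-! ### Multiplicativity in the modulus -/

/-- **Chinese remainder theorem for the binary Gauss sums**: for coprime `c₁, c₂` and integer
numerator / twist, `G(a, c₁c₂; f, w) = G(c₂a, c₁; f, w) · G(c₁a, c₂; f, w)`
(`e(n/(c₁c₂)) = e(c̄₂n/c₁)e(c̄₁n/c₂)`, then `(x, y) ↦ (c̄₂x, c̄₂y)` mod `c₁` and `(c̄₁x, c̄₁y)`
mod `c₂`, using `c₂c̄₂² ≡ c̄₂ (mod c₁)`; the two-variable form of `G_d(c) = G_{d₁}(cb₂)G_{d₂}(cb₁)`).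
[cite: AndrianovZhuravlev2015, Ch. 1 §4.5 (4.49)] -/
theorem binQuadGaussSum_mul_of_coprime {c₁ c₂ : ℕ} [NeZero c₁] [NeZero c₂] [NeZero (c₁ * c₂)]
    (h : c₁.Coprime c₂) (f : BinQF) (a w₁ w₂ : ℤ) :
    binQuadGaussSum (c₁ * c₂) f a w₁ w₂ =
      binQuadGaussSum c₁ f (c₂ * a : ℤ) w₁ w₂ * binQuadGaussSum c₂ f (c₁ * a : ℤ) w₁ w₂ := by
  classical
  set E := ZMod.chineseRemainder h with hE
  have hE1 : ∀ x, (E x).1 = ZMod.castHom (dvd_mul_right c₁ c₂) (ZMod c₁) x :=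
    fun x ↦ Prod.fst_zmod_cast x
  have hE2 : ∀ x, (E x).2 = ZMod.castHom (dvd_mul_left c₂ c₁) (ZMod c₂) x :=
    fun x ↦ Prod.snd_zmod_cast x
  set φ₁ := ZMod.castHom (dvd_mul_right c₁ c₂) (ZMod c₁) with hφ₁
  set φ₂ := ZMod.castHom (dvd_mul_left c₂ c₁) (ZMod c₂) with hφ₂
  set e₂ : ZMod c₁ := (c₂ : ZMod c₁)⁻¹ with he₂'
  set e₁ : ZMod c₂ := (c₁ : ZMod c₂)⁻¹ with he₁'
  have he₂ : (c₂ : ZMod c₁) * e₂ = 1 := ZMod.coe_mul_inv_eq_one c₂ h.symm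
  have he₁ : (c₁ : ZMod c₂) * e₁ = 1 := ZMod.coe_mul_inv_eq_one c₁ h
  have hu₂ : IsUnit e₂ := IsUnit.of_mul_eq_one (c₂ : ZMod c₁) (by rw [mul_comm]; exact he₂)
  have hu₁ : IsUnit e₁ := IsUnit.of_mul_eq_one (c₁ : ZMod c₂) (by rw [mul_comm]; exact he₁)
  -- the reindexing `v ↦ ((e₂ v₁, e₂ v₂) mod c₁, (e₁ v₁, e₁ v₂) mod c₂)`
  let T : ZMod (c₁ * c₂) × ZMod (c₁ * c₂) ≃ (ZMod c₁ × ZMod c₁) × (ZMod c₂ × ZMod c₂) :=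
    ((E.toEquiv.prodCongr E.toEquiv).trans
      (Equiv.prodProdProdComm (ZMod c₁) (ZMod c₂) (ZMod c₁) (ZMod c₂))).trans
      (Equiv.prodCongr (Equiv.prodCongr hu₂.unit.mulLeft hu₂.unit.mulLeft)
        (Equiv.prodCongr hu₁.unit.mulLeft hu₁.unit.mulLeft))
  have hT : ∀ v, T v = ((e₂ * φ₁ v.1, e₂ * φ₁ v.2), (e₁ * φ₂ v.1, e₁ * φ₂ v.2)) := by
    intro v
    simp only [T, Equiv.trans_apply, Equiv.prodCongr_apply, Prod.map_fst, Prod.map_snd,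
      Equiv.prodProdProdComm_apply, RingEquiv.toEquiv_eq_coe, EquivLike.coe_coe, hE1, hE2,
      Units.mulLeft_apply, IsUnit.unit_spec]
    rfl
  rw [binQuadGaussSum_def, binQuadGaussSum_def, binQuadGaussSum_def, Finset.sum_mul_sum,
    ← Fintype.sum_prod_type']
  refine Fintype.sum_equiv T _ _ fun v ↦ ?_
  rw [hT, stdAddChar_eq_mul_of_coprime h]
  simp only [map_add, map_mul, map_pow, map_intCast, ← he₂', ← he₁']
  congr 1
  · congr 1
    push_cast
    linear_combination (-(e₂ * (a : ZMod c₁) * ((f.a : ZMod c₁) * φ₁ v.1 ^ 2 +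
      (f.b : ZMod c₁) * φ₁ v.1 * φ₁ v.2 + (f.c : ZMod c₁) * φ₁ v.2 ^ 2))) * he₂
  · congr 1
    push_cast
    linear_combination (-(e₁ * (a : ZMod c₂) * ((f.a : ZMod c₂) * φ₂ v.1 ^ 2 +
      (f.b : ZMod c₂) * φ₂ v.1 * φ₂ v.2 + (f.c : ZMod c₂) * φ₂ v.2 ^ 2))) * he₁

end Literature.NumberTheory.ModularForms

end
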